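import Summits.AtomisticToContinuum.HydrodynamicLimit.Theorems.MourreKoopmanChargesStressStrongMixingTorusStressTrigBilinear
import HarnessLib

/-!
# `StressStrongMixing` · line `birth`, stub `stub_torusStressIdentificationTrig` (helper 3/3):
# reduction of the identification on real Fourier monomials to its diagonal core; the wavenumber-zero (MD) form

Support file for the crux item stmt-AtomisticToContinuum-9584 (`StressStrongMixing`, route `MourreKoopmanCharges` of
`AtomisticToContinuum/HydrodynamicLimit`), line `birth`, registered stub `stub_torusStressIdentificationTrig`: for every
density-one framework `F`, flow family `Φ`, wavenumbers `n, m ∈ ℤ³`, real Fourier monomials `χ₁ ∈ {Re e_n, Im e_n}`,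
`χ₂ ∈ {Re e_m, Im e_m}` and `s > 0`, `M_N(s; χ₁, χ₂) → c_F(s)·∫χ₁χ₂`, `c_F(s) = ⟪U_s ξ_Π, ξ_Π⟫_ℋ`.

The stub is NOT closed here: its diagonal content — the two-time kinetic shear-stress structure factor of the density-one
torus gas at a fixed macroscopic wavenumber converging to the infinite-volume autocorrelation — is the "dynamic Georgii"
problem (two-time local limit in law of the blown-up canonical torus process plus covariance-scale clustering uniform in
`N`; no tree fact; Spohn 1991 Part I (7.14)–(7.15) asserted).  What is proved, from the exact finite-`N` Schur relations of
helper 2/3 (`…TorusStressTrigBilinear`):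

* `torusStressMoment_tendsto_re_re/_re_im/_im_re/_im_im`, `torusStressMoment_trig_tendsto_of_diag` — for `σ ≤ 1/2`,
  `θ > 0`, a flow family, a time `s` and a constant `c`: if `M_N(s; Re e_n, Re e_n) → c·∫(Re e_n)²` for every `n`, then
  `M_N(s; χ₁, χ₂) → c·∫χ₁χ₂` for all pairs of real Fourier monomials (off resonance and for mixed pairs both sides vanish
  identically; `(Im e_n, Im e_{±n})` is `±` the diagonal by isotropy);
* `torusStressIdentificationTrig_of_diagonal` — **the registered stub follows from its diagonal core**
  `∀ F Φ n, ∀ s > 0, M_N(s; Re e_n, Re e_n) → c_F(s)·∫(Re e_n)²` (same `F`-hypotheses; `σ₂ := min σ₂ (1/2)`);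
* `torusStressMoment_wavenumber_zero` — at `n = 0` the diagonal moment is the molecular-dynamics quantity
  `(N+1)⁻¹ E_{G_N}[S(Φ_{s_N} z) S(z)]`, `S = Σᵢ vᵢ⁰vᵢ¹`, `s_N = s(N+1)^{-1/3}` (centred, so a covariance), and
  `∫(Re e_0)² = 1`: the `n = 0` core is `(N+1)⁻¹ Cov_{G_N}(S(s_N), S(0)) → c_F(s)`.

References: H. Spohn, *Large Scale Dynamics of Interacting Particles* (1991), Part I §7.1 (7.6)–(7.7), (7.14)–(7.15).
-/

noncomputable section

open MeasureTheory ProbabilityTheory Filter Topology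
open scoped InnerProductSpace ENNReal

namespace Summit.AtomisticToContinuum.HydrodynamicLimit.Theorems.MourreKoopmanChargesStressStrongMixing

open Literature.MathematicalPhysics.KineticTheory Literature.Analysis.FluidPDE

/-! ### Wavenumber zero: the molecular-dynamics form of the diagonal core -/

section WavenumberZero

open UnitAddTorus

/-- `Re e_0 = 1`. [folklore] -/
theorem re_mFourier_zero (x : T3) : (mFourier (0 : Fin 3 → ℤ) x).re = 1 := by
  simp only [mFourier_zero, ContinuousMap.one_apply, Complex.one_re]

/-- `∫ (Re e_0)² = 1`. [folklore] -/
theorem integral_re_mFourier_zero_sq : ∫ x : T3, (mFourier (0 : Fin 3 → ℤ) x).re * (mFourier (0 : Fin 3 → ℤ) x).re = 1 := by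
  simp only [re_mFourier_zero, mul_one, integral_const, probReal_univ, smul_eq_mul]

/-- **At wavenumber zero the diagonal moment is the molecular-dynamics stress autocorrelation**:
`M_N(s; Re e_0, Re e_0) = (N+1)⁻¹ · E_{G_N}[S(Φ_{s(N+1)^{-1/3}} z) · S(z)]` with the total kinetic shear stress
`S(z) = Σᵢ vᵢ⁰vᵢ¹` (and `E_{G_N}[S] = 0`, so this is `(N+1)⁻¹ Cov_{G_N}(S(s_N), S(0))`; the limit claimed by the stub
there is `c_F(s) · ∫ (Re e_0)² = c_F(s)`). [folklore] -/
theorem torusStressMoment_wavenumber_zero (σ θ : ℝ)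
    (Φ : (N : ℕ) → HardSphereFlow (Torus.geometry (Fin 3)) (hsDiameter σ N) (N + 1))
    (s : ℝ) (N : ℕ) :
    ((N : ℝ) + 1) * ∫ z, (∫ y, (mFourier (0 : Fin 3 → ℤ) y.1).re * (y.2 0 * y.2 1)
        ∂(empiricalMeasure ((Φ N).flow (s * ((N : ℝ) + 1) ^ (-(1 / 3 : ℝ))) z))) *
      (∫ y, (mFourier (0 : Fin 3 → ℤ) y.1).re * (y.2 0 * y.2 1) ∂(empiricalMeasure z))
      ∂(localGibbsLaw σ (fun _ => 1) (fun _ => 0) (fun _ => θ) N (Φ N)) =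
    ((N : ℝ) + 1)⁻¹ * ∫ z, (∑ i, ((Φ N).flow (s * ((N : ℝ) + 1) ^ (-(1 / 3 : ℝ))) z i).2 0 *
        ((Φ N).flow (s * ((N : ℝ) + 1) ^ (-(1 / 3 : ℝ))) z i).2 1) * (∑ i, (z i).2 0 * (z i).2 1)
      ∂(localGibbsLaw σ (fun _ => 1) (fun _ => 0) (fun _ => θ) N (Φ N)) := by
  have hN : ((N : ℝ) + 1) ≠ 0 := by positivity
  have hcast : (((N + 1 : ℕ) : ℝ)) = (N : ℝ) + 1 := by push_cast; ring
  simp only [re_mFourier_zero, one_mul, integral_empiricalMeasure, hcast]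
  rw [← integral_const_mul, ← integral_const_mul]
  congr 1
  funext z
  field_simp

end WavenumberZero

/-! ### Reduction of the identification on real Fourier monomials to the diagonal `(Re e_n, Re e_n)` -/

section Diagonal

open UnitAddTorus

variable {σ θ : ℝ}

/-- A sequence which vanishes identically converges to `c · 0`. [folklore] -/
theorem tendsto_const_mul_zero_of_forall_eq_zero {f : ℕ → ℝ} (hf : ∀ N, f N = 0) {c L : ℝ} (hL : L = 0) :
    Tendsto f atTop (𝓝 (c * L)) := by
  rw [hL, mul_zero, show f = fun _ => 0 from funext hf]
  exact tendsto_const_nhds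

/-- **`(Re e_n, Re e_m)`**: the diagonal hypothesis gives the limit for `m = ±n`; off resonance both sides vanish. [folklore] -/
theorem torusStressMoment_tendsto_re_re (hσ : σ ≤ 1 / 2) (hθ : 0 < θ)
    (Φ : (N : ℕ) → HardSphereFlow (Torus.geometry (Fin 3)) (hsDiameter σ N) (N + 1))
    (s c : ℝ)
    (hdiag : ∀ n : Fin 3 → ℤ, Tendsto (fun N : ℕ => ((N : ℝ) + 1) * ∫ z, (∫ y, (mFourier n y.1).re * (y.2 0 * y.2 1)
        ∂(empiricalMeasure ((Φ N).flow (s * ((N : ℝ) + 1) ^ (-(1 / 3 : ℝ))) z))) *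
      (∫ y, (mFourier n y.1).re * (y.2 0 * y.2 1) ∂(empiricalMeasure z))
      ∂(localGibbsLaw σ (fun _ => 1) (fun _ => 0) (fun _ => θ) N (Φ N))) atTop
      (𝓝 (c * ∫ x : T3, (mFourier n x).re * (mFourier n x).re)))
    (n m : Fin 3 → ℤ) :
    Tendsto (fun N : ℕ => ((N : ℝ) + 1) * ∫ z, (∫ y, (mFourier n y.1).re * (y.2 0 * y.2 1)
        ∂(empiricalMeasure ((Φ N).flow (s * ((N : ℝ) + 1) ^ (-(1 / 3 : ℝ))) z))) *
      (∫ y, (mFourier m y.1).re * (y.2 0 * y.2 1) ∂(empiricalMeasure z))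
      ∂(localGibbsLaw σ (fun _ => 1) (fun _ => 0) (fun _ => θ) N (Φ N))) atTop
      (𝓝 (c * ∫ x : T3, (mFourier n x).re * (mFourier m x).re)) := by
  by_cases hm : n - m = 0
  · obtain rfl : n = m := sub_eq_zero.1 hm
    exact hdiag n
  by_cases hp : n + m = 0
  · obtain rfl : m = -n := (neg_eq_of_add_eq_zero_right hp).symm
    have hfun : ∀ x : T3, (mFourier (-n) x).re = (mFourier n x).re := fun x => by
      rw [mFourier_neg, Complex.conj_re]
    simp_rw [hfun]
    exact hdiag n
  refine tendsto_const_mul_zero_of_forall_eq_zero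
    (fun N => (torusStressMoment_trig_offResonant hσ hθ Φ hp hm s N).1) ?_
  rw [integral_re_mul_re_mFourier, if_neg hp, if_neg hm]
  norm_num

/-- **`(Re e_n, Im e_m)`**: both sides vanish for all wavenumbers. [folklore] -/
theorem torusStressMoment_tendsto_re_im (hσ : σ ≤ 1 / 2) (hθ : 0 < θ)
    (Φ : (N : ℕ) → HardSphereFlow (Torus.geometry (Fin 3)) (hsDiameter σ N) (N + 1))
    (s c : ℝ) (n m : Fin 3 → ℤ) :
    Tendsto (fun N : ℕ => ((N : ℝ) + 1) * ∫ z, (∫ y, (mFourier n y.1).re * (y.2 0 * y.2 1)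
        ∂(empiricalMeasure ((Φ N).flow (s * ((N : ℝ) + 1) ^ (-(1 / 3 : ℝ))) z))) *
      (∫ y, (mFourier m y.1).im * (y.2 0 * y.2 1) ∂(empiricalMeasure z))
      ∂(localGibbsLaw σ (fun _ => 1) (fun _ => 0) (fun _ => θ) N (Φ N))) atTop
      (𝓝 (c * ∫ x : T3, (mFourier n x).re * (mFourier m x).im)) :=
  tendsto_const_mul_zero_of_forall_eq_zero (fun N => torusStressMoment_re_im hσ hθ Φ n m s N)
    (integral_re_mul_im_mFourier n m)

/-- **`(Im e_n, Re e_m)`**: both sides vanish for all wavenumbers. [folklore] -/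
theorem torusStressMoment_tendsto_im_re (hσ : σ ≤ 1 / 2) (hθ : 0 < θ)
    (Φ : (N : ℕ) → HardSphereFlow (Torus.geometry (Fin 3)) (hsDiameter σ N) (N + 1))
    (s c : ℝ) (n m : Fin 3 → ℤ) :
    Tendsto (fun N : ℕ => ((N : ℝ) + 1) * ∫ z, (∫ y, (mFourier n y.1).im * (y.2 0 * y.2 1)
        ∂(empiricalMeasure ((Φ N).flow (s * ((N : ℝ) + 1) ^ (-(1 / 3 : ℝ))) z))) *
      (∫ y, (mFourier m y.1).re * (y.2 0 * y.2 1) ∂(empiricalMeasure z))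
      ∂(localGibbsLaw σ (fun _ => 1) (fun _ => 0) (fun _ => θ) N (Φ N))) atTop
      (𝓝 (c * ∫ x : T3, (mFourier n x).im * (mFourier m x).re)) :=
  tendsto_const_mul_zero_of_forall_eq_zero (fun N => torusStressMoment_im_re hσ hθ Φ n m s N)
    (integral_im_mul_re_mFourier n m)

/-- **`(Im e_n, Im e_m)`**: for `m = n ≠ 0` the moments and the limit equal the `(Re e_n, Re e_n)` ones (isotropy), for
`m = -n ≠ 0` they are their negatives, for `n = m = 0` and off resonance both sides vanish. [folklore] -/
theorem torusStressMoment_tendsto_im_im (hσ : σ ≤ 1 / 2) (hθ : 0 < θ)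
    (Φ : (N : ℕ) → HardSphereFlow (Torus.geometry (Fin 3)) (hsDiameter σ N) (N + 1))
    (s c : ℝ)
    (hdiag : ∀ n : Fin 3 → ℤ, Tendsto (fun N : ℕ => ((N : ℝ) + 1) * ∫ z, (∫ y, (mFourier n y.1).re * (y.2 0 * y.2 1)
        ∂(empiricalMeasure ((Φ N).flow (s * ((N : ℝ) + 1) ^ (-(1 / 3 : ℝ))) z))) *
      (∫ y, (mFourier n y.1).re * (y.2 0 * y.2 1) ∂(empiricalMeasure z))
      ∂(localGibbsLaw σ (fun _ => 1) (fun _ => 0) (fun _ => θ) N (Φ N))) atTop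
      (𝓝 (c * ∫ x : T3, (mFourier n x).re * (mFourier n x).re)))
    (n m : Fin 3 → ℤ) :
    Tendsto (fun N : ℕ => ((N : ℝ) + 1) * ∫ z, (∫ y, (mFourier n y.1).im * (y.2 0 * y.2 1)
        ∂(empiricalMeasure ((Φ N).flow (s * ((N : ℝ) + 1) ^ (-(1 / 3 : ℝ))) z))) *
      (∫ y, (mFourier m y.1).im * (y.2 0 * y.2 1) ∂(empiricalMeasure z))
      ∂(localGibbsLaw σ (fun _ => 1) (fun _ => 0) (fun _ => θ) N (Φ N))) atTop
      (𝓝 (c * ∫ x : T3, (mFourier n x).im * (mFourier m x).im)) := by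
  by_cases hn : n = 0
  · subst hn
    refine tendsto_const_mul_zero_of_forall_eq_zero (fun N => ?_) ?_
    · simp only [mFourier_zero, ContinuousMap.one_apply, Complex.one_im, zero_mul, integral_zero, mul_zero]
    · simp only [mFourier_zero, ContinuousMap.one_apply, Complex.one_im, zero_mul, integral_zero]
  have hnn : n + n ≠ 0 := fun h => hn (by
    funext i; have := congrFun h i; simp only [Pi.add_apply, Pi.zero_apply] at this ⊢; omega)
  have hI : ∫ x : T3, (mFourier n x).im * (mFourier n x).im = ∫ x : T3, (mFourier n x).re * (mFourier n x).re := by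
    rw [integral_im_mul_im_mFourier, integral_re_mul_re_mFourier, if_neg hnn, sub_self, if_pos rfl]
    norm_num
  by_cases hm : n - m = 0
  · obtain rfl : n = m := sub_eq_zero.1 hm
    have hM := fun N => torusStressMoment_im_im_eq_re_re hσ hθ Φ hn s N
    simp_rw [hM, hI]
    exact hdiag n
  by_cases hp : n + m = 0
  · obtain rfl : m = -n := (neg_eq_of_add_eq_zero_right hp).symm
    have hfun : ∀ x : T3, (mFourier (-n) x).im = -(mFourier n x).im := fun x => by
      rw [mFourier_neg, Complex.conj_im]
    simp_rw [hfun]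
    have hneg := fun N => torusStressMoment_neg_right σ θ Φ (fun x : T3 => (mFourier n x).im)
      (fun x : T3 => (mFourier n x).im) s N
    have hM := fun N => torusStressMoment_im_im_eq_re_re hσ hθ Φ hn s N
    simp_rw [hneg, hM]
    have hlim : c * ∫ x : T3, (mFourier n x).im * -(mFourier n x).im =
        -(c * ∫ x : T3, (mFourier n x).re * (mFourier n x).re) := by
      simp_rw [mul_neg]
      rw [integral_neg, hI]
      ring
    rw [hlim]
    exact (hdiag n).neg
  refine tendsto_const_mul_zero_of_forall_eq_zero
    (fun N => (torusStressMoment_trig_offResonant hσ hθ Φ hp hm s N).2.2.2) ?_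
  rw [integral_im_mul_im_mFourier, if_neg hp, if_neg hm]
  norm_num

/-- **Reduction of the identification on real Fourier monomials to the diagonal** (`σ ≤ 1/2`, `θ > 0`, fixed flow family,
time `s` and constant `c`): if `M_N(s; Re e_n, Re e_n) → c · ∫ (Re e_n)²` for every wavenumber `n`, then
`M_N(s; χ₁, χ₂) → c · ∫ χ₁χ₂` for all pairs of real Fourier monomials `χ₁ ∈ {Re e_n, Im e_n}`, `χ₂ ∈ {Re e_m, Im e_m}`.
[folklore] -/
theorem torusStressMoment_trig_tendsto_of_diag (hσ : σ ≤ 1 / 2) (hθ : 0 < θ)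
    (Φ : (N : ℕ) → HardSphereFlow (Torus.geometry (Fin 3)) (hsDiameter σ N) (N + 1))
    (s c : ℝ)
    (hdiag : ∀ n : Fin 3 → ℤ, Tendsto (fun N : ℕ => ((N : ℝ) + 1) * ∫ z, (∫ y, (mFourier n y.1).re * (y.2 0 * y.2 1)
        ∂(empiricalMeasure ((Φ N).flow (s * ((N : ℝ) + 1) ^ (-(1 / 3 : ℝ))) z))) *
      (∫ y, (mFourier n y.1).re * (y.2 0 * y.2 1) ∂(empiricalMeasure z))
      ∂(localGibbsLaw σ (fun _ => 1) (fun _ => 0) (fun _ => θ) N (Φ N))) atTop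
      (𝓝 (c * ∫ x : T3, (mFourier n x).re * (mFourier n x).re))) :
    ∀ n m : Fin 3 → ℤ,
    ∀ χ₁ ∈ ({fun x : T3 => (UnitAddTorus.mFourier n x).re, fun x : T3 => (UnitAddTorus.mFourier n x).im} : Set (T3 → ℝ)),
    ∀ χ₂ ∈ ({fun x : T3 => (UnitAddTorus.mFourier m x).re, fun x : T3 => (UnitAddTorus.mFourier m x).im} : Set (T3 → ℝ)),
      Tendsto (fun N : ℕ => ((N : ℝ) + 1) * ∫ z, (∫ y, χ₁ y.1 * (y.2 0 * y.2 1)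
        ∂(empiricalMeasure ((Φ N).flow (s * ((N : ℝ) + 1) ^ (-(1 / 3 : ℝ))) z))) *
      (∫ y, χ₂ y.1 * (y.2 0 * y.2 1) ∂(empiricalMeasure z))
      ∂(localGibbsLaw σ (fun _ => 1) (fun _ => 0) (fun _ => θ) N (Φ N))) atTop
        (𝓝 (c * ∫ x, χ₁ x * χ₂ x)) := by
  intro n m χ₁ hχ₁ χ₂ hχ₂
  simp only [Set.mem_insert_iff, Set.mem_singleton_iff] at hχ₁ hχ₂
  rcases hχ₁ with rfl | rfl <;> rcases hχ₂ with rfl | rfl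
  · exact torusStressMoment_tendsto_re_re hσ hθ Φ s c hdiag n m
  · exact torusStressMoment_tendsto_re_im hσ hθ Φ s c n m
  · exact torusStressMoment_tendsto_im_re hσ hθ Φ s c n m
  · exact torusStressMoment_tendsto_im_im hσ hθ Φ s c hdiag n m

end Diagonal

/-! ### The registered stub from its diagonal core -/

section Stub

open UnitAddTorus

/-- **Stub `stub_torusStressIdentificationTrig` from its diagonal core.**  The registered stub (torus → `ℋ` identification
of the two-time stress moments on ALL pairs of real Fourier monomials, every density-one framework `F`, `s > 0`) follows
from the same statement restricted to the DIAGONAL pairs `(Re e_n, Re e_n)`, `n ∈ ℤ³` — the two-time kinetic shear-stress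
structure factor of the torus gas at each fixed macroscopic wavenumber — by the exact finite-`N` symmetries of this file
(`torusStressMoment_trig_tendsto_of_diag`, with `σ₂ := min σ₂ (1/2)` and `c := ⟪U_s ξ_Π, ξ_Π⟫_ℋ`).  The diagonal core is
the genuinely open content ("dynamic Georgii": two-time local limit in law of the blown-up canonical torus process plus
covariance-scale clustering uniform in `N`; Spohn 1991 Part I (7.14)–(7.15)). [folklore] -/
theorem torusStressIdentificationTrig_of_diagonal :
    (∃ σ₂ : ℝ, 0 < σ₂ ∧ ∀ σ : ℝ, 0 < σ → σ < σ₂ → ∀ θ : ℝ, 0 < θ → ∀ z : ℝ, 0 < z →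
      ∀ F : HardSphereFluctuationData σ,
        (IsHardSphereGibbs σ z θ⁻¹ (0 : V3) F.μ ∧
          (∫ ω, cellCharge 0 ω ∂F.μ = 1) ∧
          (∃ Φ : InfiniteHardSphereFlow (Fin 3) σ, Φ.IsEquilibriumFlow ∧ ∀ t : ℝ, F.flow t =ᵐ[F.μ] Φ.flow t) ∧
          cellObs (fun v : V3 => v 0 * v 1) ∈ F.localObs) →
        ∀ Φ : (N : ℕ) → HardSphereFlow (Torus.geometry (Fin 3)) (hsDiameter σ N) (N + 1),
        ∀ n : Fin 3 → ℤ, ∀ s : ℝ, 0 < s →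
          Tendsto (fun N : ℕ => ((N : ℝ) + 1) * ∫ z, (∫ y, (mFourier n y.1).re * (y.2 0 * y.2 1)
        ∂(empiricalMeasure ((Φ N).flow (s * ((N : ℝ) + 1) ^ (-(1 / 3 : ℝ))) z))) *
      (∫ y, (mFourier n y.1).re * (y.2 0 * y.2 1) ∂(empiricalMeasure z))
      ∂(localGibbsLaw σ (fun _ => 1) (fun _ => 0) (fun _ => θ) N (Φ N))) atTop
            (𝓝 (⟪F.koopman s (F.fluct (cellObs fun v : V3 => v 0 * v 1)),
                  F.fluct (cellObs fun v : V3 => v 0 * v 1)⟫_ℝ * ∫ x : T3, (mFourier n x).re * (mFourier n x).re))) →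
    ∃ σ₂ : ℝ, 0 < σ₂ ∧ ∀ σ : ℝ, 0 < σ → σ < σ₂ → ∀ θ : ℝ, 0 < θ → ∀ z : ℝ, 0 < z →
      ∀ F : HardSphereFluctuationData σ,
        (IsHardSphereGibbs σ z θ⁻¹ (0 : V3) F.μ ∧
          (∫ ω, cellCharge 0 ω ∂F.μ = 1) ∧
          (∃ Φ : InfiniteHardSphereFlow (Fin 3) σ, Φ.IsEquilibriumFlow ∧ ∀ t : ℝ, F.flow t =ᵐ[F.μ] Φ.flow t) ∧
          cellObs (fun v : V3 => v 0 * v 1) ∈ F.localObs) →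
        ∀ Φ : (N : ℕ) → HardSphereFlow (Torus.geometry (Fin 3)) (hsDiameter σ N) (N + 1),
        ∀ n m : Fin 3 → ℤ,
        ∀ χ₁ ∈ ({fun x : T3 => (UnitAddTorus.mFourier n x).re, fun x : T3 => (UnitAddTorus.mFourier n x).im} : Set (T3 → ℝ)),
        ∀ χ₂ ∈ ({fun x : T3 => (UnitAddTorus.mFourier m x).re, fun x : T3 => (UnitAddTorus.mFourier m x).im} : Set (T3 → ℝ)),
        ∀ s : ℝ, 0 < s →
          Tendsto (fun N : ℕ => ((N : ℝ) + 1) * ∫ z, (∫ y, χ₁ y.1 * (y.2 0 * y.2 1)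
        ∂(empiricalMeasure ((Φ N).flow (s * ((N : ℝ) + 1) ^ (-(1 / 3 : ℝ))) z))) *
      (∫ y, χ₂ y.1 * (y.2 0 * y.2 1) ∂(empiricalMeasure z))
      ∂(localGibbsLaw σ (fun _ => 1) (fun _ => 0) (fun _ => θ) N (Φ N))) atTop
            (𝓝 (⟪F.koopman s (F.fluct (cellObs fun v : V3 => v 0 * v 1)),
                  F.fluct (cellObs fun v : V3 => v 0 * v 1)⟫_ℝ * ∫ x, χ₁ x * χ₂ x)) := by
  intro hdiag
  obtain ⟨σ₂, hσ₂, H⟩ := hdiag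
  refine ⟨min σ₂ (1 / 2), lt_min hσ₂ (by norm_num), ?_⟩
  intro σ hσ hσlt θ hθ z hz F hF Φ n m χ₁ hχ₁ χ₂ hχ₂ s hs
  have h₁ : σ < σ₂ := lt_of_lt_of_le hσlt (min_le_left _ _)
  have h₂ : σ ≤ 1 / 2 := (lt_of_lt_of_le hσlt (min_le_right _ _)).le
  exact torusStressMoment_trig_tendsto_of_diag h₂ hθ Φ s _ (fun k => H σ hσ h₁ θ hθ z hz F hF Φ k s hs)
    n m χ₁ hχ₁ χ₂ hχ₂

end Stub

end Summit.AtomisticToContinuum.HydrodynamicLimit.Theorems.MourreKoopmanChargesStressStrongMixing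

end
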